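import Literature.NumberTheory.Automorphic.RootData
import Literature.NumberTheory.Automorphic.RegularFunctionsGL
import HarnessLib

/-!
# The open big cell of a connected reductive group, as a named fact
(trunk T-AUTOMORPHIC, G25 AutomorphicL; Springer, *Linear Algebraic Groups*, 8.3.6 (ii), 8.3.11, 8.2.1)

Companion to `RootData.lean` and `RegularFunctionsGL.lean` (namespace `Literature.Automorphic`, concrete
vocabulary of items I1–I2: `G, T ≤ GL n k`, root homomorphisms `IsRootHom`, root data
`IsRootDatumOf`, regular functions on principal opens `IsRegularOnGL`). It vendors the input to
step 2 of Springer's proof of the isomorphism theorem 9.6.2 ("the restriction of `φ` to the open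
set `C(w₀)` of 8.3.11 is a morphism … the translates `g.C(w₀)` cover `G`"), namely the **open big
cell**: for `G` connected reductive with maximal torus `T`, a system of positive roots `R⁺`,
`U = ∏_{α ∈ R⁺} U_α ≅ 𝔸^{|R⁺|}` (Springer 8.2.1) and `U⁻ = ∏_{α ∈ -R⁺} U_α`, the product map
`U⁻ × T × U → G` is an isomorphism of varieties onto the open subvariety `Ω = U⁻ T U = ẇ₀⁻¹ C(w₀)`
(Springer 8.3.6 (ii) for `w = w₀`, and 8.3.11: `C(w₀) = B ẇ₀ B` is the unique open double coset;
uniqueness of the decomposition is Bruhat's lemma 8.3.9).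

* `CoordsRegularOnGL Z d F` (definition + API): all coordinates of a `GL m k`-valued function are
  regular on `Z ∩ {d ≠ 0}`; closed under products, list products, left translation, and under
  applying algebraic homomorphisms `𝔾ₐ → G` / `G → GL m'` (`of_isAlgebraicAddHom`,
  `of_isAlgebraicGL`). All proved. [folklore]
* `BigCellChart G T u` (structure, the *data* of the inverse chart): an open neighbourhood
  `Ω = G ∩ ⋃_{d ∈ D} {d ≠ 0}` of `1` and functions `x_i, y_i` (for `i` in two lists of root
  indices), `t` (values in `T`), regular on each `G ∩ {d ≠ 0}`, with
  `g = ∏ u_i(x_i(g)) · t(g) · ∏ u_i(y_i(g))` on `Ω`.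
* `nonempty_bigCellChart` (**named fact**, Springer 8.3.6 (ii), 8.3.11, 8.2.1): for `G`
  connected reductive over an algebraically closed field of characteristic `0`, `T` a maximal
  torus with root datum `P` and root homomorphisms `u_i` of all roots, a `BigCellChart G T u`
  exists. (Any root homomorphism `u_i` for `α_i` is Springer's `u_{α_i}` up to `x ↦ c x`,
  8.1.1 (i), so Springer's chart rescaled is such a chart; an open subset of `G` is a finite
  union of principal opens by noetherianity, and a regular function on `Ω ⊇ G ∩ {d ≠ 0}`
  restricts to an element of `k[G]_d`, 1.4.6.) The existential form records exactly what the
  regularity argument of 9.6.2 consumes (`ReductiveDualProofs`); the printed theorem is stronger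
  (it identifies `Ω`, the index lists and asserts bijectivity).

Proving `nonempty_bigCellChart` needs the structure theory of Ch. 6–8 (Borel subgroups,
`U = ∏ U_α` 8.2.1–8.2.3, Bruhat's lemma 8.3.8, dimension theory and 5.3.2 (iii) for the
isomorphism onto the image), none of which exists for this vocabulary or in Mathlib.

## References

* T. A. Springer, *Linear Algebraic Groups*, 2nd ed. (1998), 6.3.5 (iv), 8.1.1, 8.1.12 (2),
  8.2.1, 8.3.6, 8.3.9, 8.3.11, 1.4.5–1.4.6, and the proof of 9.6.2 [SpringerLAG1998].
-/

open scoped IsMulCommutative MatrixGroups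

namespace Literature.NumberTheory.Automorphic

variable {k : Type*} [Field k] {n : Type*} [Fintype n] [DecidableEq n]
variable {m : Type*} [Fintype m] [DecidableEq m] {m' : Type*} [Fintype m'] [DecidableEq m']

/-! ### `GL`-valued functions with regular coordinates -/

/-- All coordinates (entries and `det⁻¹`) of the `GL m k`-valued function `F` on `GL n k` are
regular on the principal open subset `Z ∩ {d ≠ 0}` (`IsRegularOnGL`). [folklore] -/
def CoordsRegularOnGL (Z : Set (GL n k)) (d : MvPolynomial (GLCoord n) k) (F : GL n k → GL m k) :
    Prop :=
  ∀ c : GLCoord m, IsRegularOnGL Z d fun g => glCoordFun (F g) c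

namespace IsRegularOnGL

variable {Z : Set (GL n k)} {d : MvPolynomial (GLCoord n) k} {c : GL n k → k}

/-- Powers of regular functions are regular. [folklore] -/
lemma pow (hc : IsRegularOnGL Z d c) (i : ℕ) : IsRegularOnGL Z d fun g => c g ^ i := by
  induction i with
  | zero => simpa using const (Z := Z) (d := d) 1
  | succ i ih => simpa [pow_succ] using ih.mul hc

/-- Substituting a regular function into a one-variable polynomial gives a regular function.
[folklore] -/
lemma polynomial_eval (hc : IsRegularOnGL Z d c) (p : Polynomial k) :
    IsRegularOnGL Z d fun g => p.eval (c g) := by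
  induction p using Polynomial.induction_on' with
  | add p q hp hq => simpa [Polynomial.eval_add] using hp.add hq
  | monomial i a => simpa [Polynomial.eval_monomial] using (const (Z := Z) (d := d) a).mul (hc.pow i)

end IsRegularOnGL

namespace CoordsRegularOnGL

variable {Z : Set (GL n k)} {d : MvPolynomial (GLCoord n) k} {F F' : GL n k → GL m k}

/-- Constant `GL`-valued functions have regular coordinates. [folklore] -/
lemma const (x : GL m k) : CoordsRegularOnGL Z d fun _ : GL n k => x :=
  fun c => IsRegularOnGL.const (glCoordFun x c)

/-- The identity function of `GL n k` has regular coordinates. [folklore] -/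
lemma id : CoordsRegularOnGL Z d fun g : GL n k => g :=
  fun c => IsRegularOnGL.coord c

/-- A function agreeing on `Z ∩ {d ≠ 0}` with one having regular coordinates has regular
coordinates. [folklore] -/
lemma congr (hF : CoordsRegularOnGL Z d F)
    (h : ∀ g ∈ Z, MvPolynomial.eval (glCoordFun g) d ≠ 0 → F' g = F g) : CoordsRegularOnGL Z d F' :=
  fun c => (hF c).congr fun g hg hd => by rw [h g hg hd]

/-- Products of `GL`-valued functions with regular coordinates have regular coordinates
(multiplication on `GL` is polynomial, `eval_mulPolyGL`). [folklore] -/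
lemma mul (hF : CoordsRegularOnGL Z d F) (hF' : CoordsRegularOnGL Z d F') :
    CoordsRegularOnGL Z d fun g => F g * F' g := by
  intro c
  have hcs : ∀ s : GLCoord m ⊕ GLCoord m, IsRegularOnGL Z d
      (fun g => Sum.elim (glCoordFun (F g)) (glCoordFun (F' g)) s) := by
    rintro (s | s)
    · exact hF s
    · exact hF' s
  have h := IsRegularOnGL.eval_comp
    (cs := fun (s : GLCoord m ⊕ GLCoord m) g => Sum.elim (glCoordFun (F g)) (glCoordFun (F' g)) s)
    hcs (mulPolyGL c)
  refine h.congr fun g _ _ => ?_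
  exact (eval_mulPolyGL (F g) (F' g) c).symm

/-- List products of `GL`-valued functions with regular coordinates have regular coordinates.
[folklore] -/
lemma list_prod {ι' : Type*} (l : List ι') {F : ι' → GL n k → GL m k}
    (hF : ∀ i ∈ l, CoordsRegularOnGL Z d (F i)) :
    CoordsRegularOnGL Z d fun g => (l.map fun i => F i g).prod := by
  induction l with
  | nil => simpa using const (Z := Z) (d := d) (1 : GL m k)
  | cons a l ih =>
    simpa using (hF a (by simp)).mul (ih fun i hi => hF i (by simp [hi]))

/-- An algebraic homomorphism `u : 𝔾ₐ → G ≤ GL m k` applied to a regular function gives a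
function with regular coordinates. [folklore] -/
lemma of_isAlgebraicAddHom {G : Subgroup (GL m k)} {u : Multiplicative k →* ↥G}
    (hu : IsAlgebraicAddHom u) {c : GL n k → k} (hc : IsRegularOnGL Z d c) :
    CoordsRegularOnGL Z d fun g => ((u (Multiplicative.ofAdd (c g)) : ↥G) : GL m k) := by
  obtain ⟨Pu, hPu⟩ := hu
  intro c'
  exact (hc.polynomial_eval (Pu c')).congr fun g _ _ => hPu (c g) c'

/-- An algebraic homomorphism `f : G → GL m' k` (`G ≤ GL m k`) applied to a `G`-valued function
with regular coordinates gives a function with regular coordinates. [folklore] -/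
lemma of_isAlgebraicGL {G : Subgroup (GL m k)} {f : ↥G →* GL m' k} (hf : MonoidHom.IsAlgebraicGL f)
    (hF : CoordsRegularOnGL Z d F) (hmem : ∀ g, F g ∈ G) :
    CoordsRegularOnGL Z d fun g => f ⟨F g, hmem g⟩ := by
  obtain ⟨Pf, hPf⟩ := hf
  intro c'
  exact (IsRegularOnGL.eval_comp (cs := fun c g => glCoordFun (F g) c) hF (Pf c')).congr
    fun g _ _ => hPf ⟨F g, hmem g⟩ c'

end CoordsRegularOnGL

/-! ### Composition with a left translation of the group -/

/-- Evaluating a polynomial composed with the left-translation polynomials. [folklore] -/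
lemma eval_bind₁_leftMulPolyGL (h g : GL n k) (q : MvPolynomial (GLCoord n) k) :
    MvPolynomial.eval (glCoordFun g) (MvPolynomial.bind₁ (leftMulPolyGL h) q) =
      MvPolynomial.eval (glCoordFun (h * g)) q := by
  rw [eval_bind₁]
  have e : (fun i => MvPolynomial.eval (glCoordFun g) (leftMulPolyGL h i)) = glCoordFun (h * g) :=
    funext fun c => eval_leftMulPolyGL h g c
  rw [e]

/-- A function regular on `G ∩ {d ≠ 0}` composed with left translation by `h ∈ G` is regular on
the translated principal open `G ∩ {d(h ·) ≠ 0}`. [folklore] -/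
lemma IsRegularOnGL.comp_mul_left {G : Subgroup (GL n k)} {d : MvPolynomial (GLCoord n) k}
    {c : GL n k → k} (hc : IsRegularOnGL (G : Set (GL n k)) d c) {h : GL n k} (hh : h ∈ G) :
    IsRegularOnGL (G : Set (GL n k)) (MvPolynomial.bind₁ (leftMulPolyGL h) d) fun g => c (h * g) := by
  obtain ⟨p, N, hp⟩ := hc
  refine ⟨MvPolynomial.bind₁ (leftMulPolyGL h) p, N, fun g hg hd => ?_⟩
  rw [eval_bind₁_leftMulPolyGL] at hd ⊢
  rw [eval_bind₁_leftMulPolyGL]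
  exact hp (h * g) (G.mul_mem hh hg) hd

/-- Same for `GL`-valued functions with regular coordinates. [folklore] -/
lemma CoordsRegularOnGL.comp_mul_left {G : Subgroup (GL n k)} {d : MvPolynomial (GLCoord n) k}
    {F : GL n k → GL m k} (hF : CoordsRegularOnGL (G : Set (GL n k)) d F) {h : GL n k}
    (hh : h ∈ G) :
    CoordsRegularOnGL (G : Set (GL n k)) (MvPolynomial.bind₁ (leftMulPolyGL h) d) fun g => F (h * g) :=
  fun c => (hF c).comp_mul_left hh

/-! ### The big cell -/

section BigCell

variable {ι : Type*} (G T : Subgroup (GL n k))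

/-- **Data of the open big cell.** For root homomorphisms `u = (u_i)_{i ∈ ι}` of `(G, T)`, a
`BigCellChart G T u` records an open neighbourhood `Ω = G ∩ ⋃_{d ∈ D} {d ≠ 0}` of `1` in `G`
(a finite union of principal open subsets) together with functions `x_i, y_i : Ω → k`
(`i` running over two lists `Lneg`, `Lpos` of indices) and `t : Ω → T`, all regular on each
`G ∩ {d ≠ 0}`, `d ∈ D`, such that every `g ∈ Ω` decomposes as
`g = (∏_{i ∈ Lneg} u_i(x_i(g))) · t(g) · (∏_{i ∈ Lpos} u_i(y_i(g)))`.
For `G` connected reductive with maximal torus `T`, `Lpos` a numbering of a system of positive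
roots `R⁺` and `Lneg` one of `-R⁺`, this is the inverse of Springer's isomorphism of varieties
`U⁻ × T × U ≅ Ω = U⁻·T·U` onto the open big cell (`U = ∏_{α > 0} U_α ≅ 𝔸^{|R⁺|}` by 8.2.1,
`Ω = ẇ₀⁻¹ C(w₀)` open by 8.3.6 (ii), 8.3.11); the functions are extended arbitrarily (with
`t ∈ T`) outside `Ω`, where nothing is claimed. [cite: SpringerLAG1998, 8.3.6 (ii), 8.3.11 and 8.2.1] -/
structure BigCellChart (u : ι → Multiplicative k →* ↥G) where
  /-- Indices of the root homomorphisms in the left unipotent factor (a numbering of `-R⁺`). -/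
  Lneg : List ι
  /-- Indices of the root homomorphisms in the right unipotent factor (a numbering of `R⁺`). -/
  Lpos : List ι
  /-- Denominators: `Ω = G ∩ ⋃_{d ∈ D} {d ≠ 0}`. -/
  D : Finset (MvPolynomial (GLCoord n) k)
  /-- The coordinates of the left unipotent factor. -/
  xc : ι → GL n k → k
  /-- The coordinates of the right unipotent factor. -/
  yc : ι → GL n k → k
  /-- The torus factor. -/
  tc : GL n k → GL n k
  /-- `1 ∈ Ω`. -/
  one_mem : ∃ d ∈ D, MvPolynomial.eval (glCoordFun (1 : GL n k)) d ≠ 0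
  /-- The `x_i` are regular on each `G ∩ {d ≠ 0}`. -/
  xc_regular : ∀ d ∈ D, ∀ i, IsRegularOnGL (G : Set (GL n k)) d (xc i)
  /-- The `y_i` are regular on each `G ∩ {d ≠ 0}`. -/
  yc_regular : ∀ d ∈ D, ∀ i, IsRegularOnGL (G : Set (GL n k)) d (yc i)
  /-- The torus factor has regular coordinates on each `G ∩ {d ≠ 0}`. -/
  tc_regular : ∀ d ∈ D, CoordsRegularOnGL (G : Set (GL n k)) d tc
  /-- The torus factor lies in `T` (everywhere, by the choice of extension). -/
  tc_mem : ∀ g, tc g ∈ T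
  /-- The decomposition `g = ∏ u_i(x_i(g)) · t(g) · ∏ u_i(y_i(g))` on `Ω`. -/
  prod_eq : ∀ g ∈ G, (∃ d ∈ D, MvPolynomial.eval (glCoordFun g) d ≠ 0) →
    g = (Lneg.map fun i => ((u i (Multiplicative.ofAdd (xc i g)) : ↥G) : GL n k)).prod * tc g *
      (Lpos.map fun i => ((u i (Multiplicative.ofAdd (yc i g)) : ↥G) : GL n k)).prod

variable {X Y : Type*} [AddCommGroup X] [AddCommGroup Y] {G T} [IsMulCommutative ↥T]

/-- **The open big cell** (Springer, *Linear Algebraic Groups*, 8.3.6 (ii) and 8.3.11 with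
8.2.1; also 8.3.9). Let `G` be connected reductive over an algebraically closed field of
characteristic `0` (Springer: any characteristic; characteristic `0` is the case fixed by the
consumer `Literature.NumberTheory.Automorphic.chevalley_isomorphism`, and the extra hypothesis only weakens the fact), `T` a
maximal torus, `P` the root datum of `(G, T)` and `u_i` a root
homomorphism for each root `α_i` (`i ∈ ι`). Let `R⁺` be a system of positive roots,
`U = ∏_{α ∈ R⁺} U_α` and `U⁻ = ∏_{α ∈ -R⁺} U_α` (products in any fixed order; isomorphisms of
varieties `𝔸^{|R⁺|} ≅ U`, `(x_α) ↦ ∏ u_α(x_α)`, 8.2.1). Then the product map `U⁻ × T × U → G` is an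
isomorphism of varieties onto an open subvariety `Ω` of `G`, the big cell: `(u, b) ↦ u ẇ₀ b` is an
isomorphism `U × B ≅ C(w₀) = B ẇ₀ B` (8.3.6 (ii) with `w = w₀`, `U_{w₀} = U`), `T × U ≅ B`
(6.3.5 (iv)), `ẇ₀⁻¹ U ẇ₀ = U⁻` (8.1.12 (2)), so `Ω = ẇ₀⁻¹ C(w₀) = U⁻ T U`, and `C(w₀)` is the
unique open double coset (8.3.11; uniqueness of the decomposition is 8.3.9). Recorded here through its
consequence for the inverse chart: there is a `BigCellChart G T u` — an open neighbourhood `Ω`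
of `1` in `G` and regular functions `x_i, y_i, t` on `Ω` with
`g = ∏_{i ∈ Lneg} u_i(x_i(g)) · t(g) · ∏_{i ∈ Lpos} u_i(y_i(g))` for `g ∈ Ω`. This is the input
to step 2 of the proof of the isomorphism theorem 9.6.2.
[cite: SpringerLAG1998, 8.3.6 (ii), 8.3.11 with 8.2.1 and 6.3.5 (iv)] -/
def nonempty_bigCellChart : Prop :=
  ∀ [IsAlgClosed k] [CharZero k] (_hG : IsConnectedReductive G) (_hT : IsMaximalTorusIn T G)
    {P : RootPairing ι ℤ X Y} {eX : Additive ↥(characterLattice T) ≃+ X}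
    {eY : Additive ↥(cocharacterLattice T) ≃+ Y} (h : IsRootDatumOf G T P eX eY)
    (u : ι → Multiplicative k →* ↥G)
    (_hu : ∀ i, IsRootHom G T h.le (charOfWeight eX (P.root i)) (u i)),
    Nonempty (BigCellChart G T u)

end BigCell

end Literature.NumberTheory.Automorphic
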